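/-
Copyright: the b2b-balaban T⁴-continuum CRUX team, row NE7b OWNER lineage `t4-ne7b-p1` (gen 122). Project licence.
-/
import Summits.QuantumFields.BalabanUV.T4Continuum.Spine.NE7b.SupTorusSupNormRoad
import Summits.QuantumFields.BalabanUV.T4Continuum.Spine.NE7b.SupTorusPerturbedResponse

/-!
# THE `ℓ^∞` LETTERS OF THE PERTURBED ROAD: `(H + K)⁻¹`, `T_K⁻¹` AND THE FLUCTUATION COVARIANCE `C_K` ARE BOUNDED ON `ℓ^∞`, MESH- AND
# VOLUME-FREE (`d ≥ 3` for the fine-lattice letters) — (152) `supNorm_bound_road` and (157) RE-RUN for `H + K` by a one-line perturbation: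
# `Hu = f − Ku`, `‖Ku‖_∞ ≤ εK_γ‖u‖_∞`, and `C₀εK_γ ≤ ½` absorbs (row NE7b, node U5c; (152)∕(157)∕(163)∕(166)∕(168) BY NAME; [folklore])

Cell `pub-balaban`, sub-cell `t4`, spine estimate NE7b (`T4WeightBudget.RelWeightBound`; the cell's OWN estimate — NOT PRINTED in
[Bałaban 1983–89], NOT PROVED).  Crux-route work under `Spine/NE7b/` by the row OWNER (`t4-ne7b-p1` gen 122, file (170)) under FREEZE
(0)'s crux-prover clause; NOTHING of Bałaban's is named as a Lean object, valued or asserted; no `T4Continuum/Support` leaf typed; no `def`,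
no notation; zero `sorry`.  Imports (BY NAME): the OWNER's (152) `…SupTorusSupNormRoad` (`supNorm_bound_road`), (168)
`…SupTorusPerturbedResponse` (`perturbed_superposition_equation`; through it (166) `perturbed_nextScale_hessian_local`, (163) `rowsum_le`,
(132) `torus_sum_exp_le`).

WHY (located).  (152)–(157) built the `ℓ^∞` (pointwise) theory of the road's class from `PoissonInterior.interior_estimate`; the perturbed
Hessian `H + K` (the class the road's step produces, (102)∕(135)∕(166)) inherits the `ℓ^∞` BOUND by perturbation — no second interior
estimate is needed: if `(H + K)u = f` then `Hu = f − Ku` with `|Ku| ≤ εK_γ‖u‖_∞` ((163) `rowsum_le`), so (152) gives `‖u‖_∞ ≤ C₀(‖f‖_∞ +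
εK_γ‖u‖_∞)` and `ε ≤ ε₀ := 1∕(2C₀K_γ + 1)` absorbs.  With (166) (`T_K⁻¹` decays) the coarse letter and the covariance letter of (157) follow
word for word.  (The pointwise DECAY of `(H + K)⁻¹f` does not follow by this perturbation — (154)'s rate is not reproduced — and remains a
re-run of (153)∕(154).)

WHAT IS PROVED ([folklore]; fine torus `Site d ((n+1)s)`, coarse `Site d s`; `(H + K)u` DISPLAYED; `K_α = (2∕(1 − e^{−α}))^d`; `T_K` as `Matrix.of`):
* §1 `abs_blockMean_le_of_sup` (`|u| ≤ U` ⟹ `|(n+1)^{−d}Σ_z u(σ(chart (wm y) z))| ≤ U`).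
* §2 **`perturbed_supNorm_bound`** (`d ≥ 3`, `a > 0`, `λ < min(2,a)`, `Λ ≥ 0`, `γ > 0`): THERE ARE `ε₀, C > 0` such that for ALL `n, s`, ALL
  `−λ ≤ V ≤ Λ`, ALL kernels `|K(x,z)| ≤ ε₀e^{−γρ_N(x,z)}`, every `|f| ≤ M` and every `(H + K)u = f`: `|u x| ≤ C·M` at every site.
* §3 **`perturbed_nextScale_inverse_supNorm`** (`a > 0`, `λ < min(2,a)`, `Λ ≥ 0`, `ε ≥ 0`, `γ > 1`, `εK_{γ−1} ≤ (min(2,a) − λ)∕4`): `∃ C > 0`,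
  for ALL `n, s, V, K` (symmetric, `|K| ≤ εe^{−γρ_N}`), block columns `ψ^K`, coarse `|k| ≤ M_k`: `|Σ_{y′}T_K⁻¹(y,y′)k(y′)| ≤ C·M_k`.
* §4 **`perturbed_covariance_supNorm`** (`d ≥ 3`, `γ > 1`): THERE ARE `ε₀, C > 0` such that for ALL `n, s`, `−λ ≤ V ≤ Λ`, symmetric
  `|K| ≤ ε₀e^{−γρ_N}` with block columns `ψ^K`, every `|f| ≤ M`, `(H + K)u = f`: `|u x − h x| ≤ C·M`, `h = Σ_{y′}(T_K⁻¹Q′tu)(y′)ψ^K_{y′}`.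
* §5 toy.

HONEST (what this is NOT).  `ℓ^∞` BOUNDS only — the pointwise exponential DECAY of `(H + K)⁻¹`, its gradient bound and the volume
comparison for `H + K` remain re-runs of (153)–(161); cubic periods; scalar skeleton ((A3), NC-NE7b-α UNRULED); nothing of Bałaban's.
BY-NAME EFFECT ON THE WALL: NONE.  NE7b NOT PRINTED ∕ NOT PROVED; spine PROVED 0∕9; rung (B)+1 on a FINITE torus — NOT infinite volume, NOT
the mass gap, NOT Clay.  HONEST DEPENDENCY: continuum YM on T⁴ ⇐ BetaPertH ∧ nine spine estimates (0∕9 proved); BetaPertH ⇐ (D1) ∧ (D4) ∧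
CAP+tail; G-an2-4 gates asym, D1 and NE2∕3∕4.
-/

set_option autoImplicit false

noncomputable section

namespace Summit.QuantumFields.BalabanUV.T4Continuum.NE7b.SupTorusPerturbedSupNorm

open Real
open Literature.MathematicalPhysics.QuantumFieldTheory.Balaban1983to89
open B6QGQLower276 (X e blk B side chart mem_B sum_B sum_B_const card_cube blk_chart)
open Beta (Site siteOf windowMap siteOf_windowMap siteOf_add)
open SupTorusBlockDistance (torus_sum_exp_le)
open SupTorusSupNormRoad (supNorm_bound_road)
open SupTorusPerturbedKernelSums (rowsum_le)
open SupTorusPerturbedCoarseFloor (perturbed_nextScale_hessian_local)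
open SupTorusPerturbedResponse (kernelSum_anti perturbed_superposition_equation)

variable {d : ℕ}

/-! ## §1. Block means are bounded by the sup -/

/-- `|u| ≤ U` ⟹ every block mean satisfies `|(n+1)^{−d}Σ_z u(σ(chart (wm y) z))| ≤ U`. [folklore] -/
theorem abs_blockMean_le_of_sup (n s : ℕ) [NeZero s] (u : Site d ((n + 1) * s) → ℝ) {U : ℝ} (hu : ∀ x, |u x| ≤ U) (y : Site d s) :
    |(((n : ℝ) + 1) ^ d)⁻¹ * ∑ z : Fin d → Fin (n + 1), u (siteOf d ((n + 1) * s) (chart n (windowMap d s y) z))| ≤ U := by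
  have hvol : (0 : ℝ) < ((n : ℝ) + 1) ^ d := by positivity
  rw [abs_mul, abs_inv, abs_of_pos hvol, inv_mul_le_iff₀ hvol]
  calc |∑ z : Fin d → Fin (n + 1), u (siteOf d ((n + 1) * s) (chart n (windowMap d s y) z))|
      ≤ ∑ z : Fin d → Fin (n + 1), |u (siteOf d ((n + 1) * s) (chart n (windowMap d s y) z))| := Finset.abs_sum_le_sum_abs _ _
    _ ≤ ∑ _z : Fin d → Fin (n + 1), U := Finset.sum_le_sum fun z _ => hu _
    _ = ((n : ℝ) + 1) ^ d * U := by rw [Finset.sum_const, Finset.card_univ, nsmul_eq_mul, card_cube]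

/-! ## §2. `(H + K)⁻¹` is bounded on `ℓ^∞` for small exponentially local kernels -/

/-- **HEADLINE — THE PERTURBED PROPAGATOR `(H + K)⁻¹` IS BOUNDED ON `ℓ^∞`, MESH- AND VOLUME-FREE, `d ≥ 3`.**  Fix `d ≥ 3`, `a > 0`,
`λ < min(2,a)`, `Λ ≥ 0`, `γ > 0`.  THERE ARE `ε₀, C > 0` (functions of these and of (152)'s constant only) such that for ALL `n, s`, ALL
`−λ ≤ V ≤ Λ`, ALL kernels `|K(x,z)| ≤ ε₀e^{−γρ_N(x,z)}`, every source `|f| ≤ M` and every solution of `(H + K)u = f`: `|u x| ≤ C·M` at EVERY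
site — `Hu = f − Ku`, `|Ku| ≤ ε₀K_γ‖u‖_∞` ((163) `rowsum_le`), (152) at the maximum of `|u|`, and `C₀ε₀K_γ ≤ ½` absorbs. [folklore] -/
theorem perturbed_supNorm_bound (hd : 3 ≤ d) (a : ℝ) (ha : 0 < a) {lam Lam γ : ℝ} (hlam : lam < min 2 a) (hLam : 0 ≤ Lam) (hγ : 0 < γ) :
    ∃ ε₀ C : ℝ, 0 < ε₀ ∧ 0 < C ∧ ∀ (n s : ℕ) [NeZero s] (V : Site d ((n + 1) * s) → ℝ), (∀ x, -lam ≤ V x) → (∀ x, V x ≤ Lam) →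
      ∀ K : Site d ((n + 1) * s) → Site d ((n + 1) * s) → ℝ,
      (∀ x z, |K x z| ≤ ε₀ * exp (-(γ * ∑ i, (((x i - z i).valMinAbs.natAbs : ℕ) : ℝ)))) →
      ∀ (M : ℝ) (u f : Site d ((n + 1) * s) → ℝ), (∀ x, |f x| ≤ M) →
      (∀ x, ((n : ℝ) + 1) ^ 2 * ∑ μ, (2 * u x - u (x + siteOf d ((n + 1) * s) (e μ)) - u (x - siteOf d ((n + 1) * s) (e μ)))
        + a / ((n : ℝ) + 1) ^ d * ∑ q ∈ B n (blk n (windowMap d ((n + 1) * s) x)), u (siteOf d ((n + 1) * s) q) + V x * u x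
        + ∑ z, K x z * u z = f x) →
      ∀ x : Site d ((n + 1) * s), |u x| ≤ C * M := by
  classical
  obtain ⟨C₀, hC₀, H0⟩ := supNorm_bound_road (d := d) hd a ha hlam hLam
  set Kγ : ℝ := (2 * (1 - exp (-γ))⁻¹) ^ d with hKγ
  have hKγ0 : 0 ≤ Kγ := pow_nonneg (mul_nonneg zero_le_two (inv_nonneg.2 (sub_nonneg.2 (exp_le_one_iff.2 (by linarith))))) d
  have hpos : 0 < 2 * C₀ * Kγ + 1 := by positivity
  refine ⟨1 / (2 * C₀ * Kγ + 1), 2 * C₀, by positivity, by positivity, ?_⟩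
  intro n s _ V hV hV' K hK M u f hfM hu x
  have hε0 : 0 ≤ 1 / (2 * C₀ * Kγ + 1) := by positivity
  -- the maximum of `|u|`
  obtain ⟨x₀, hx₀⟩ := Finite.exists_max fun x : Site d ((n + 1) * s) => |u x|
  have hU0 : 0 ≤ |u x₀| := abs_nonneg _
  have hrow : ∀ x', ∑ z, |K x' z| ≤ 1 / (2 * C₀ * Kγ + 1) * Kγ := fun x' => rowsum_le ((n + 1) * s) K hε0 hK hγ x'
  -- `|Ku| ≤ ε₀K_γ‖u‖_∞`
  have hKu : ∀ x', |∑ z, K x' z * u z| ≤ 1 / (2 * C₀ * Kγ + 1) * Kγ * |u x₀| := fun x' =>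
    calc |∑ z, K x' z * u z| ≤ ∑ z, |K x' z * u z| := Finset.abs_sum_le_sum_abs _ _
      _ ≤ ∑ z, |K x' z| * |u x₀| :=
          Finset.sum_le_sum fun z _ => by rw [abs_mul]; exact mul_le_mul_of_nonneg_left (hx₀ z) (abs_nonneg _)
      _ = (∑ z, |K x' z|) * |u x₀| := (Finset.sum_mul _ _ _).symm
      _ ≤ _ := mul_le_mul_of_nonneg_right (hrow x') hU0
  -- `Hu = f − Ku`, a source of size `M + ε₀K_γ‖u‖_∞`
  have hu' : ∀ x', ((n : ℝ) + 1) ^ 2 * ∑ μ, (2 * u x' - u (x' + siteOf d ((n + 1) * s) (e μ)) - u (x' - siteOf d ((n + 1) * s) (e μ)))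
      + a / ((n : ℝ) + 1) ^ d * ∑ q ∈ B n (blk n (windowMap d ((n + 1) * s) x')), u (siteOf d ((n + 1) * s) q) + V x' * u x'
      = f x' - ∑ z, K x' z * u z := fun x' => by have := hu x'; linarith
  have hf' : ∀ x', |f x' - ∑ z, K x' z * u z| ≤ M + 1 / (2 * C₀ * Kγ + 1) * Kγ * |u x₀| := fun x' =>
    (abs_sub _ _).trans (add_le_add (hfM x') (hKu x'))
  have h0 := H0 n s V hV hV' (M + 1 / (2 * C₀ * Kγ + 1) * Kγ * |u x₀|) u (fun x' => f x' - ∑ z, K x' z * u z) hf' hu' x₀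
  -- absorb: `C₀ε₀K_γ ≤ ½`
  have hcoef : C₀ * (1 / (2 * C₀ * Kγ + 1) * Kγ) ≤ 1 / 2 := by
    have e1 : C₀ * (1 / (2 * C₀ * Kγ + 1) * Kγ) = C₀ * Kγ / (2 * C₀ * Kγ + 1) := by ring
    rw [e1, div_le_iff₀ hpos]
    nlinarith [mul_nonneg hC₀.le hKγ0]
  have hU1 : |u x₀| ≤ C₀ * M + 1 / 2 * |u x₀| :=
    calc |u x₀| ≤ C₀ * (M + 1 / (2 * C₀ * Kγ + 1) * Kγ * |u x₀|) := h0
      _ = C₀ * M + C₀ * (1 / (2 * C₀ * Kγ + 1) * Kγ) * |u x₀| := by ring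
      _ ≤ C₀ * M + 1 / 2 * |u x₀| := by have := mul_le_mul_of_nonneg_right hcoef hU0; linarith
  have hU2 : |u x₀| ≤ 2 * C₀ * M := by linarith
  exact (hx₀ x).trans hU2

/-! ## §3. `T_K⁻¹` is bounded on `ℓ^∞` of the coarse torus -/

/-- **`‖T_K⁻¹‖_{ℓ^∞→ℓ^∞} ≤ c₁K_{δ₁}`** for ALL `n, s`, ALL `−λ ≤ V ≤ Λ`, ALL symmetric kernels `|K| ≤ εe^{−γρ_N}` (`γ > 1`, `εK_{γ−1} ≤
(min(2,a) − λ)∕4`) and their block columns `ψ^K`: every coarse `|k| ≤ M_k` has `|Σ_{y′}T_K⁻¹(y,y′)k(y′)| ≤ C·M_k` — (166)'s entry decay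
summed with (132) `torus_sum_exp_le` ((157) §1 by name). [folklore] -/
theorem perturbed_nextScale_inverse_supNorm (a : ℝ) (ha : 0 < a) {lam Lam ε γ : ℝ} (hm0 : 0 < min 2 a - lam) (hLam : 0 ≤ Lam)
    (hε : 0 ≤ ε) (hγ : 1 < γ) (hεs : ε * (2 * (1 - exp (-(γ - 1)))⁻¹) ^ d ≤ (min 2 a - lam) / 4) :
    ∃ C : ℝ, 0 < C ∧ ∀ (n s : ℕ) [NeZero s] (V : Site d ((n + 1) * s) → ℝ), (∀ x, -lam ≤ V x) → (∀ x, V x ≤ Lam) →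
      ∀ K : Site d ((n + 1) * s) → Site d ((n + 1) * s) → ℝ, (∀ x z, K x z = K z x) →
      (∀ x z, |K x z| ≤ ε * exp (-(γ * ∑ i, (((x i - z i).valMinAbs.natAbs : ℕ) : ℝ)))) →
      ∀ ψ : Site d s → Site d ((n + 1) * s) → ℝ,
      (∀ y' x, ((n : ℝ) + 1) ^ 2 * ∑ μ, (2 * ψ y' x - ψ y' (x + siteOf d ((n + 1) * s) (e μ)) - ψ y' (x - siteOf d ((n + 1) * s) (e μ)))
        + a / ((n : ℝ) + 1) ^ d * ∑ q ∈ B n (blk n (windowMap d ((n + 1) * s) x)), ψ y' (siteOf d ((n + 1) * s) q) + V x * ψ y' x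
        + ∑ z, K x z * ψ y' z = if siteOf d s (blk n (windowMap d ((n + 1) * s) x)) = y' then 1 else 0) →
      ∀ (k : Site d s → ℝ) (Mk : ℝ), (∀ y, |k y| ≤ Mk) → ∀ y : Site d s,
        |∑ y', (Matrix.of fun yy y'' : Site d s =>
            (((n : ℝ) + 1) ^ d)⁻¹ * ∑ z : Fin d → Fin (n + 1), ψ y'' (siteOf d ((n + 1) * s) (chart n (windowMap d s yy) z)))⁻¹ y y' * k y'|
          ≤ C * Mk := by
  classical
  obtain ⟨c₁, δ₁, hc₁, hδ₁, H166⟩ := perturbed_nextScale_hessian_local (d := d) a ha hm0 hLam hε hγ hεs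
  set Kδ : ℝ := (2 * (1 - exp (-δ₁))⁻¹) ^ d with hKδ
  have hKδ0 : 0 < Kδ := pow_pos (mul_pos two_pos (inv_pos.2 (sub_pos.2 (exp_lt_one_iff.2 (by linarith))))) d
  refine ⟨c₁ * Kδ, by positivity, ?_⟩
  intro n s _ V hV hV' K hKs hK ψ hψ k Mk hk y
  set T : Matrix (Site d s) (Site d s) ℝ := Matrix.of fun yy y'' : Site d s =>
    (((n : ℝ) + 1) ^ d)⁻¹ * ∑ z : Fin d → Fin (n + 1), ψ y'' (siteOf d ((n + 1) * s) (chart n (windowMap d s yy) z)) with hT_def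
  have hMk : 0 ≤ Mk := (abs_nonneg _).trans (hk y)
  have hsum : ∑ y' : Site d s, exp (-(δ₁ * ∑ i, (((y i - y' i).valMinAbs.natAbs : ℕ) : ℝ))) ≤ Kδ := torus_sum_exp_le (d := d) s hδ₁ y
  have hTinv : ∀ y' : Site d s, |T⁻¹ y y'| ≤ c₁ * exp (-(δ₁ * ∑ i, (((y i - y' i).valMinAbs.natAbs : ℕ) : ℝ))) :=
    fun y' => H166 n s V hV hV' K hKs hK ψ hψ y y'
  have hterm : ∀ y' : Site d s, |T⁻¹ y y' * k y'| ≤ c₁ * Mk * exp (-(δ₁ * ∑ i, (((y i - y' i).valMinAbs.natAbs : ℕ) : ℝ))) :=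
    fun y' => by
    rw [abs_mul]
    calc |T⁻¹ y y'| * |k y'| ≤ (c₁ * exp (-(δ₁ * ∑ i, (((y i - y' i).valMinAbs.natAbs : ℕ) : ℝ)))) * Mk :=
          mul_le_mul (hTinv y') (hk y') (abs_nonneg _) (by positivity)
      _ = _ := by ring
  have hfin : ∑ y' : Site d s, |T⁻¹ y y' * k y'| ≤ c₁ * Mk * Kδ :=
    calc ∑ y' : Site d s, |T⁻¹ y y' * k y'|
        ≤ ∑ y' : Site d s, c₁ * Mk * exp (-(δ₁ * ∑ i, (((y i - y' i).valMinAbs.natAbs : ℕ) : ℝ))) :=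
          Finset.sum_le_sum fun y' _ => hterm y'
      _ = c₁ * Mk * ∑ y' : Site d s, exp (-(δ₁ * ∑ i, (((y i - y' i).valMinAbs.natAbs : ℕ) : ℝ))) := (Finset.mul_sum _ _ _).symm
      _ ≤ c₁ * Mk * Kδ := mul_le_mul_of_nonneg_left hsum (by positivity)
  have hend : c₁ * Mk * Kδ = c₁ * Kδ * Mk := by ring
  exact ((Finset.abs_sum_le_sum_abs _ _).trans hfin).trans hend.le

/-! ## §4. The fluctuation covariance of `H + K` is bounded on `ℓ^∞`, every source -/

/-- **`‖C_K‖_{ℓ^∞→ℓ^∞} ≤ C` FOR SMALL EXPONENTIALLY LOCAL SYMMETRIC KERNELS, `d ≥ 3`, every mesh, every volume, EVERY source.**  Fix `d ≥ 3`,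
`a > 0`, `λ < min(2,a)`, `Λ ≥ 0`, `γ > 1`.  THERE ARE `ε₀, C > 0` such that for ALL `n, s`, ALL `−λ ≤ V ≤ Λ`, ALL symmetric kernels
`|K(x,z)| ≤ ε₀e^{−γρ_N(x,z)}` with block columns `ψ^K`, every `|f| ≤ M` and `(H + K)u = f`: `|u x − h x| ≤ C·M` with `h = Σ_{y′}c y′·ψ^K_{y′}`,
`c = T_K⁻¹(Q′tu)` — `‖u‖_∞ ≤ C₀M` (§2), block means `≤ C₀M` (§1), `|c| ≤ C₁C₀M` (§3), `(H + K)h = c∘bt` ((168)), `‖h‖_∞ ≤ C₀C₁C₀M` (§2). [folklore] -/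
theorem perturbed_covariance_supNorm (hd : 3 ≤ d) (a : ℝ) (ha : 0 < a) {lam Lam γ : ℝ} (hlam : lam < min 2 a) (hLam : 0 ≤ Lam)
    (hγ : 1 < γ) :
    ∃ ε₀ C : ℝ, 0 < ε₀ ∧ 0 < C ∧ ∀ (n s : ℕ) [NeZero s] (V : Site d ((n + 1) * s) → ℝ), (∀ x, -lam ≤ V x) → (∀ x, V x ≤ Lam) →
      ∀ K : Site d ((n + 1) * s) → Site d ((n + 1) * s) → ℝ, (∀ x z, K x z = K z x) →
      (∀ x z, |K x z| ≤ ε₀ * exp (-(γ * ∑ i, (((x i - z i).valMinAbs.natAbs : ℕ) : ℝ)))) →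
      ∀ ψ : Site d s → Site d ((n + 1) * s) → ℝ,
      (∀ y' x, ((n : ℝ) + 1) ^ 2 * ∑ μ, (2 * ψ y' x - ψ y' (x + siteOf d ((n + 1) * s) (e μ)) - ψ y' (x - siteOf d ((n + 1) * s) (e μ)))
        + a / ((n : ℝ) + 1) ^ d * ∑ q ∈ B n (blk n (windowMap d ((n + 1) * s) x)), ψ y' (siteOf d ((n + 1) * s) q) + V x * ψ y' x
        + ∑ z, K x z * ψ y' z = if siteOf d s (blk n (windowMap d ((n + 1) * s) x)) = y' then 1 else 0) →
      ∀ (M : ℝ) (u f : Site d ((n + 1) * s) → ℝ), (∀ x, |f x| ≤ M) →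
      (∀ x, ((n : ℝ) + 1) ^ 2 * ∑ μ, (2 * u x - u (x + siteOf d ((n + 1) * s) (e μ)) - u (x - siteOf d ((n + 1) * s) (e μ)))
        + a / ((n : ℝ) + 1) ^ d * ∑ q ∈ B n (blk n (windowMap d ((n + 1) * s) x)), u (siteOf d ((n + 1) * s) q) + V x * u x
        + ∑ z, K x z * u z = f x) →
      ∀ x : Site d ((n + 1) * s),
        |u x - ∑ y', (∑ y'', (Matrix.of fun yy y'' : Site d s =>
              (((n : ℝ) + 1) ^ d)⁻¹ * ∑ z : Fin d → Fin (n + 1), ψ y'' (siteOf d ((n + 1) * s) (chart n (windowMap d s yy) z)))⁻¹ y' y''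
            * ((((n : ℝ) + 1) ^ d)⁻¹ * ∑ z'' : Fin d → Fin (n + 1), u (siteOf d ((n + 1) * s) (chart n (windowMap d s y'') z''))))
            * ψ y' x| ≤ C * M := by
  classical
  have hm0 : 0 < min 2 a - lam := by linarith
  obtain ⟨ε₁, C₀, hε₁, hC₀, H0⟩ := perturbed_supNorm_bound (d := d) hd a ha hlam hLam (γ := γ) (by linarith)
  -- the kernel size: small for §2 AND for (166)
  set K1 : ℝ := (2 * (1 - exp (-(γ - 1)))⁻¹) ^ d with hK1
  have hK10 : 0 < K1 := pow_pos (mul_pos two_pos (inv_pos.2 (sub_pos.2 (exp_lt_one_iff.2 (by linarith))))) d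
  set ε₀ : ℝ := min ε₁ ((min 2 a - lam) / 4 / K1) with hε₀
  have hε₀0 : 0 < ε₀ := lt_min hε₁ (by positivity)
  have hε₀1 : ε₀ ≤ ε₁ := min_le_left _ _
  have hεs : ε₀ * (2 * (1 - exp (-(γ - 1)))⁻¹) ^ d ≤ (min 2 a - lam) / 4 := by
    calc ε₀ * K1 ≤ (min 2 a - lam) / 4 / K1 * K1 := mul_le_mul_of_nonneg_right (min_le_right _ _) hK10.le
      _ = (min 2 a - lam) / 4 := div_mul_cancel₀ _ hK10.ne'
  obtain ⟨C₁, hC₁, H1⟩ := perturbed_nextScale_inverse_supNorm (d := d) a ha hm0 hLam hε₀0.le hγ hεs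
  refine ⟨ε₀, C₀ * (1 + C₁ * C₀), hε₀0, by positivity, ?_⟩
  intro n s _ V hV hV' K hKs hK ψ hψ M u f hfM hu x
  set T : Matrix (Site d s) (Site d s) ℝ := Matrix.of fun yy y'' : Site d s =>
    (((n : ℝ) + 1) ^ d)⁻¹ * ∑ z : Fin d → Fin (n + 1), ψ y'' (siteOf d ((n + 1) * s) (chart n (windowMap d s yy) z)) with hT_def
  have hM : 0 ≤ M := (abs_nonneg _).trans (hfM x)
  have hK' : ∀ x' z, |K x' z| ≤ ε₁ * exp (-(γ * ∑ i, (((x' i - z i).valMinAbs.natAbs : ℕ) : ℝ))) :=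
    fun x' z => (hK x' z).trans (mul_le_mul_of_nonneg_right hε₀1 (exp_pos _).le)
  set mean : Site d s → ℝ := fun y'' =>
    (((n : ℝ) + 1) ^ d)⁻¹ * ∑ z'' : Fin d → Fin (n + 1), u (siteOf d ((n + 1) * s) (chart n (windowMap d s y'') z'')) with hmean_def
  set cc : Site d s → ℝ := fun y' => ∑ y'' : Site d s, T⁻¹ y' y'' * mean y'' with hcc
  set hfl : Site d ((n + 1) * s) → ℝ := fun x => ∑ y' : Site d s, cc y' * ψ y' x with hhfl
  -- `‖u‖_∞ ≤ C₀M`, block means `≤ C₀M`, coefficients `≤ C₁C₀M`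
  have husup : ∀ x', |u x'| ≤ C₀ * M := fun x' => H0 n s V hV hV' K hK' M u f hfM hu x'
  have hmeanb : ∀ y'', |mean y''| ≤ C₀ * M := fun y'' => abs_blockMean_le_of_sup n s u husup y''
  have hcoef : ∀ y', |cc y'| ≤ C₁ * (C₀ * M) := fun y' => H1 n s V hV hV' K hKs hK ψ hψ mean (C₀ * M) hmeanb y'
  -- `(H + K)hfl = cc∘bt`, so `‖hfl‖_∞ ≤ C₀C₁C₀M`
  have hHfl : ∀ x', ((n : ℝ) + 1) ^ 2 * ∑ μ, (2 * hfl x' - hfl (x' + siteOf d ((n + 1) * s) (e μ)) - hfl (x' - siteOf d ((n + 1) * s) (e μ)))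
      + a / ((n : ℝ) + 1) ^ d * ∑ q ∈ B n (blk n (windowMap d ((n + 1) * s) x')), hfl (siteOf d ((n + 1) * s) q) + V x' * hfl x'
      + ∑ z, K x' z * hfl z = cc (siteOf d s (blk n (windowMap d ((n + 1) * s) x'))) :=
    fun x' => perturbed_superposition_equation n a s V K ψ hψ cc x'
  have h1 := H0 n s V hV hV' K hK' (C₁ * (C₀ * M)) hfl (fun x' => cc (siteOf d s (blk n (windowMap d ((n + 1) * s) x'))))
    (fun x' => hcoef _) hHfl x
  have h2 := husup x
  have h3 : |u x - hfl x| ≤ C₀ * M + C₀ * (C₁ * (C₀ * M)) := (abs_sub _ _).trans (add_le_add h2 h1)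
  simp only [hhfl, hcc, hmean_def] at h3
  refine h3.trans (le_of_eq ?_)
  ring

/-! ## §5. Toy -/

/-- Toy (`d = 3`, `a = 1`, `λ = 0`, `Λ = 1`, `γ = 2`): the kernel size and the constant of the perturbed `ℓ^∞` letter exist. -/
example : ∃ ε₀ C : ℝ, 0 < ε₀ ∧ 0 < C :=
  let ⟨ε₀, C, hε₀, hC, _⟩ := perturbed_supNorm_bound (d := 3) le_rfl 1 one_pos (lam := 0) (Lam := 1) (γ := 2)
    (by norm_num) zero_le_one two_pos
  ⟨ε₀, C, hε₀, hC⟩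

end Summit.QuantumFields.BalabanUV.T4Continuum.NE7b.SupTorusPerturbedSupNorm
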